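import Summits.RiemannHypothesis.RiemannHypothesis.Theorems.HandoffLoadCeiling
import Summits.RiemannHypothesis.RiemannHypothesis.Theorems.SemilocalSoninPrimeWindow
import Mathlib.Algebra.BigOperators.Group.Finset.Powerset
import HarnessLib

/-!
# HANDOFF — the INTERACTION HIERARCHY and the RELAY DEFECT of the semi-local forms, TYPED, with their RH-free frame (cell rh-explicit, TRACK «HANDOFF», seat theory-2 gen5)

HONEST FRAMING. Nothing here bears on the truth of RH; everything below is RH-free bookkeeping on the tree's semi-local ground
energies `λ_min(S; a; P)` (`HandoffSemilocalEnergy.semilocalGroundEnergy`). SEMILOCAL-TABLE §2/§2e/§3 (DATA-CUT-0823 items (2), (3))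
tabulate the one-place INCREMENTS `Δ_p = λ({p}) − λ(∅)`, the pair INTERACTIONS `I_pq`, the connected `k`-body CUMULANTS
`J_T := Σ_{R ⊆ T} (−1)^{|T|−|R|} λ(R)` («no decay with order» through `k = 10`, CERTIFIED), the «pair model» residual, and the RELAY
defects `d_S(t) = λ(S; t) − λ(full; t)` («0.004 … 2.3»). None had a name in the tree. This file types them — `semilocalCumulant B T P a`
(base `B`, place set `T`; `B = ∅` gives the tables' `J_T`, `T = {p}` the increment, `T = {p, q}` the interaction) and the PLACE CAP
`placeCap p a = 2 Σ_{p^m ≤ e^{2a}} (log p) p^{−m/2}` — and proves what every such table must respect, for every sector `P`, junk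
surface (`a ≤ 0`) included:
* §2–§3 ONE-PLACE SANDWICH **`|λ_min(S ∪ {p}; a; P) − λ_min(S; a; P)| ≤ placeCap(p, a)`** (every finite `S`, prime `p`, window, sector;
  the general form of `HandoffLoadCeiling`'s `|ε − λ_min(S_q)| ≤ cap(q)`) and LOCALITY: equality for `a ≤ (log p)/2` (the tables' zeros).
* §4 CUMULANTS: pairing formula; **a cumulant containing an invisible prime VANISHES** (`semilocalCumulant_eq_zero_of_le`; the «—»
  cells); **`|J_T| ≤ 2^{|T|−1}·placeCap(p, a)` for every `p ∈ T`** (`abs_semilocalCumulant_le`) — a-priori, honest and far from the data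
  (b = 17/10, |T| = 10, p = 29: `2⁹·2(log 29)/√29 ≈ 6.4e2` vs certified `J = 0.228`; the kernel predicts no decay with order, the data
  show none); MÖBIUS INVERSION `λ(B ∪ T) = Σ_{R ⊆ T} J^B_R` — the identity defining the «pair model» residual as `Σ_{|R| ≥ 3} J_R`.
* §5 RELAY, NOT CONVERGENCE: **`|λ_min(S; a; P) − inf_P Q| ≤ Σ_{p ≤ N prime, p ∉ S} placeCap(p, a)`** for `a ≤ (log(N+1))/2` — the defect
  is carried by the VISIBLE MISSING primes and is exactly `0` when there are none (tree `semilocalGroundEnergy_eq_of_forall`): at fixed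
  bandwidth «convergence in S» is finite and exact; the deficits measure the relay (SEMILOCAL-TABLE §3 v0.10).
* §6 HANDOFF LINK (consecutive `q < q'`): the GAIN of HANDOFF-STATEMENT §H.3 is the one-body cumulant `G_q(b; P) = J^{S_q}_{{q}}(b; P)`;
  `= 0` for `b ≤ (log q)/2`, `= ε(b) + D_q(b)` and `|·| ≤ cap(q)` on the window, and **`H(q) ⟺ D_q((log q')/2) ≤ G_q((log q')/2)`** —
  «aggregate deficit ≤ aggregate GAIN» is the one aggregate reading that is an equivalence (with `cap(q)` for the gain: necessary only).

References (as printed): A. Connes, C. Consani, Enseign. Math. 69 (2023) = arXiv:2106.01715, §2.1 (`W_p`), §2.2–2.4 (smallest eigenvalue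
with/without a prime) [`ConnesConsani2023`]; E. Bombieri, Rend. Mat. Acc. Lincei (9) 11 (2000) §4 Lemmas 2–3 [`Bombieri2000Weil`]; H. Yoshida,
Adv. Stud. Pure Math. 21 (1992) §2 eq. (2.1) [`Yoshida1992HermitianForms`]. Cumulants/Möbius: [folklore]; the objects are this cell's, not in print.
-/

set_option linter.dupNamespace false  -- the mandated namespace repeats `RiemannHypothesis`

noncomputable section
open Set Complex MeasureTheory Literature.NumberTheory.LFunctions
open Summit.RiemannHypothesis.RiemannHypothesis.Theorems.Handoff
open Summit.RiemannHypothesis.RiemannHypothesis.Theorems.HandoffAnalytic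
open Summit.RiemannHypothesis.RiemannHypothesis.Theorems.HandoffSemilocalEnergy
open Summit.RiemannHypothesis.RiemannHypothesis.Theorems.HandoffLoadCeiling
open Summit.RiemannHypothesis.RiemannHypothesis.Theorems.MotivicDoor.SemilocalThreshold
open Summit.RiemannHypothesis.RiemannHypothesis.Theorems.MotivicDoor.Semilocal
open scoped Real ComplexConjugate ArithmeticFunction.vonMangoldt

namespace Summit.RiemannHypothesis.RiemannHypothesis.Theorems.HandoffInteraction

variable {g : ℝ → ℂ} {S T U B : Finset ℕ} {P : (ℝ → ℂ) → Prop} {a b : ℝ} {p q q' N : ℕ}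

/-! ## §1  The objects -/

/-- **The place cap** `placeCap p a := 2 Σ_{n ≤ e^{2a}} Λ_{{p}}(n)/√n = 2 Σ_{m ≥ 1, p^m ≤ e^{2a}} (log p) p^{−m/2}`: twice the
total explicit-formula weight of the powers of `p` visible on the window `[−a, a]` (the kernel `k = g ⋆ g̃` lives on `[−2a, 2a]`
and `|k| ≤ ‖g‖₂²`). For `(log p)/2 < a < log p` only `m = 1` is visible and `placeCap p a = 2(log p)/√p = w_p`, the atom weight
(twice `HandoffLoadCeiling`'s sharp `cap(p)`). [cite: ConnesConsani2023, §2.1 (W_p(F) = (log p) Σ_m p^{-m/2}(F(p^m) + F(p^{-m})))] -/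
def placeCap (p : ℕ) (a : ℝ) : ℝ :=
  2 * ∑ n ∈ Finset.range (⌊Real.exp (2 * a)⌋₊ + 1), weilSemilocalCoeff {p} n

/-- **The semi-local cumulant** `J^B_T(a; P) := Σ_{R ⊆ T} (−1)^{|T|−|R|} λ_min(B ∪ R; a; P)` — the connected `|T|`-body term of
the semi-local ground energy in the places `T` over the base `B` (SEMILOCAL-TABLE §2e with `B = ∅`: `J_∅ = λ(∅)`,
`J_{p} = Δ_p = λ({p}) − λ(∅)`, `J_{pq} = I_pq = λ({p,q}) − λ({p}) − λ({q}) + λ(∅)`, …). DEFINITION ONLY (a finite signed sum of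
the tree's `semilocalGroundEnergy`; junk `0` for `a ≤ 0` inherited). [folklore] -/
def semilocalCumulant (B T : Finset ℕ) (P : (ℝ → ℂ) → Prop) (a : ℝ) : ℝ :=
  ∑ R ∈ T.powerset, (-1 : ℝ) ^ (T.card - R.card) * semilocalGroundEnergy (B ∪ R) P a

/-- The place cap is non-negative. [folklore] -/
theorem placeCap_nonneg (p : ℕ) (a : ℝ) : 0 ≤ placeCap p a :=
  mul_nonneg zero_le_two (Finset.sum_nonneg fun n _ ↦ weilSemilocalCoeff_nonneg _ n)

/-- `J^B_∅ = λ_min(B)`. [folklore] -/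
theorem semilocalCumulant_empty (B : Finset ℕ) (P : (ℝ → ℂ) → Prop) (a : ℝ) :
    semilocalCumulant B ∅ P a = semilocalGroundEnergy B P a := by
  simp [semilocalCumulant]

/-- **On the handoff window the place cap is the atom weight**: for a prime `q` and `(log q)/2 ≤ b < log q` only the first power of
`q` is visible (`q ≤ e^{2b} < q²`), so `placeCap q b = 2(log q)/√q = w_q` — twice `HandoffLoadCeiling`'s sharp `cap(q) = (log q)/√q`
(the factor 2 is the crude `|k(x) + k(−x)| ≤ 2‖g‖₂²`; on the window `|k(log q) + k(−log q)| ≤ ‖g‖₂²`, `HandoffEdgeLayer`).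
[cite: ConnesConsani2023, §2.1 (W_p) and §2.2 (log 2 ≤ L < log 3: the single term of the prime 2)] -/
theorem placeCap_eq_atomWeight (hq : q.Prime) (hb : Real.log q / 2 ≤ b) (hb' : b < Real.log q) :
    placeCap q b = 2 * (Real.log q / Real.sqrt q) := by
  have hq0 : (0 : ℝ) < q := by exact_mod_cast hq.pos
  set N : ℕ := ⌊Real.exp (2 * b)⌋₊ with hN
  have hqN : q ≤ N := by
    rw [hN]
    refine Nat.le_floor ?_
    calc (q : ℝ) = Real.exp (Real.log q) := (Real.exp_log hq0).symm
      _ ≤ Real.exp (2 * b) := Real.exp_le_exp.2 (by linarith)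
  have hNq : N < q ^ 2 := by
    have h1 : (N : ℝ) ≤ Real.exp (2 * b) := Nat.floor_le (Real.exp_pos _).le
    have h2 : Real.exp (2 * b) < (q : ℝ) ^ 2 := by
      rw [← Real.exp_log (pow_pos hq0 2), Real.log_pow]
      push_cast
      exact Real.exp_lt_exp.2 (by linarith)
    exact_mod_cast h1.trans_lt h2
  unfold placeCap
  rw [Finset.sum_eq_single q]
  · unfold weilSemilocalCoeff
    rw [hq.primeFactors, if_pos (Finset.Subset.refl _), ArithmeticFunction.vonMangoldt_apply_prime hq]
  · intro n hn hne
    by_cases hpp : IsPrimePow n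
    · obtain ⟨p, m, hp, hm, rfl⟩ := (isPrimePow_nat_iff n).1 hpp
      have hpf : (p ^ m).primeFactors = {p} := Nat.primeFactors_prime_pow hm.ne' hp
      by_cases hpq : p = q
      · subst hpq
        have hlt : p ^ m < p ^ 2 := lt_of_le_of_lt (Nat.le_of_lt_succ (Finset.mem_range.1 hn)) hNq
        have hm2 : m < 2 := (Nat.pow_lt_pow_iff_right hp.one_lt).1 hlt
        interval_cases m
        exact absurd (pow_one _) hne
      · unfold weilSemilocalCoeff
        rw [hpf, if_neg (by simpa using hpq)]
    · exact weilSemilocalCoeff_of_not_isPrimePow _ hpp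
  · intro h
    exact absurd (Finset.mem_range.2 (Nat.lt_succ_of_le hqN)) h

/-! ## §2  The place term of one prime is bounded by the place cap -/

/-- **`‖W_{{p}}(k)‖ ≤ placeCap(p, a)·M₀`** for a continuous kernel `k` with `tsupport k ⊆ [−2a, 2a]` and `‖k‖ ≤ M₀`: only the
powers `p^m ≤ e^{2a}` enter (the tree's finite-sum form `weilSemilocalPrimeTerm_eq_sum_of_tsupport_subset`), each with weight
`(log p) p^{−m/2}` against `|k(m log p) + k(−m log p)| ≤ 2M₀`. [cite: Bombieri2000Weil, §4 Lemma 3 (finite prime sum on a window), for the single place p] -/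
theorem norm_weilSemilocalPrimeTerm_singleton_le (p : ℕ) {k : ℝ → ℂ} (hk : Continuous k) {M₀ : ℝ}
    (hsupp : tsupport k ⊆ Icc (-(2 * a)) (2 * a)) (hM : ∀ t, ‖k t‖ ≤ M₀) :
    ‖weilSemilocalPrimeTerm {p} k‖ ≤ placeCap p a * M₀ := by
  set N : ℕ := ⌊Real.exp (2 * a)⌋₊ with hN
  have hb : 2 * a ≤ Real.log ((N : ℝ) + 1) := by
    have h1 : Real.exp (2 * a) < (N : ℝ) + 1 := by rw [hN]; exact Nat.lt_floor_add_one _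
    have := Real.log_le_log (Real.exp_pos _) h1.le
    rwa [Real.log_exp] at this
  have hsupp' : tsupport k ⊆ Icc (-Real.log ((N : ℝ) + 1)) (Real.log ((N : ℝ) + 1)) :=
    hsupp.trans (Icc_subset_Icc (neg_le_neg hb) hb)
  rw [weilSemilocalPrimeTerm_eq_sum_of_tsupport_subset {p} hk N hsupp']
  calc ‖∑ n ∈ Finset.range (N + 1), (weilSemilocalCoeff {p} n : ℂ) * (k (Real.log n) + k (-Real.log n))‖
      ≤ ∑ n ∈ Finset.range (N + 1), weilSemilocalCoeff {p} n * (2 * M₀) := by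
        refine norm_sum_le_of_le _ fun n _ ↦ ?_
        rw [norm_mul, Complex.norm_real, Real.norm_of_nonneg (weilSemilocalCoeff_nonneg _ _)]
        have hkk : ‖k (Real.log n) + k (-Real.log n)‖ ≤ 2 * M₀ :=
          (norm_add_le _ _).trans (by linarith [hM (Real.log n), hM (-Real.log n)])
        exact mul_le_mul_of_nonneg_left hkk (weilSemilocalCoeff_nonneg _ _)
    _ = placeCap p a * M₀ := by rw [← Finset.sum_mul, placeCap]; ring

/-- **Pointwise one-place sandwich**: for a prime `p`, any finite `S` and `g ∈ C(a)`,
`|Re Q_{S ∪ {p}}(g) − Re Q_S(g)| ≤ placeCap(p, a)·‖g‖₂²` (additivity in the places `Re Q_{S ∪ {p}} = Re Q_S − Re W_p(g ⋆ g̃)`,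
`HandoffAnalytic`; Bombieri's `|g ⋆ g̃| ≤ ‖g‖₂²`; trivially `0` if `p ∈ S`). [cite: Bombieri2000Weil, §4 Lemma 2 (|f * g*| ≤ ‖f‖‖g‖) and Lemma 3] -/
theorem abs_re_weilSemilocalQuadratic_insert_sub_le (hp : p.Prime) (S : Finset ℕ) (hg : IsWeilTest g)
    (hsupp : tsupport g ⊆ Icc (-a) a) :
    |(weilSemilocalQuadratic (insert p S) g).re - (weilSemilocalQuadratic S g).re| ≤
      placeCap p a * ∫ t, ‖g t‖ ^ 2 := by
  by_cases hpS : p ∈ S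
  · rw [Finset.insert_eq_of_mem hpS, sub_self, abs_zero]
    exact mul_nonneg (placeCap_nonneg p a) (integral_nonneg fun _ ↦ by positivity)
  · have hk : IsWeilTest (weilConv g (weilReflect g)) := hg.weilConv hg.weilReflect
    have h := norm_weilSemilocalPrimeTerm_singleton_le p hk.1.continuous
      (tsupport_weilConv_weilReflect_subset hg.2 hsupp) (norm_weilConv_weilReflect_le hg)
    rw [re_weilSemilocalQuadratic_insert hp hpS hg, sub_sub_cancel_left, abs_neg]
    exact (Complex.abs_re_le_norm _).trans h

/-! ## §3  One-place sandwich and locality for the ground energies (every `S`, `p`, `a`, sector) -/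

/-- The semi-local value sets of two place sets are empty together (they are indexed by the same test functions). [folklore] -/
theorem semilocalSphereValues_eq_empty_iff (S T : Finset ℕ) (P : (ℝ → ℂ) → Prop) (a : ℝ) :
    semilocalSphereValues S P a = ∅ ↔ semilocalSphereValues T P a = ∅ := by
  rw [← Set.not_nonempty_iff_eq_empty, ← Set.not_nonempty_iff_eq_empty, semilocalSphereValues_nonempty_iff,
    semilocalSphereValues_nonempty_iff]

/-- **ONE-PLACE SANDWICH (RH-free)**: `|λ_min(S ∪ {p}; a; P) − λ_min(S; a; P)| ≤ placeCap(p, a)` for every finite `S`, prime `p`,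
window `a` and sector `P` — inserting one place moves the bottom of the spectrum by at most the visible weight of that place.
(Junk surface included: for an empty sphere both energies are `0`.) [cite: ConnesConsani2023, §2.2–2.4 (smallest eigenvalue with and without the prime); bound: this track] -/
theorem abs_semilocalGroundEnergy_insert_sub_le (hp : p.Prime) (S : Finset ℕ) (P : (ℝ → ℂ) → Prop) (a : ℝ) :
    |semilocalGroundEnergy (insert p S) P a - semilocalGroundEnergy S P a| ≤ placeCap p a := by
  rcases (semilocalSphereValues S P a).eq_empty_or_nonempty with he | hne
  · have he' : semilocalSphereValues (insert p S) P a = ∅ := (semilocalSphereValues_eq_empty_iff _ S P a).2 he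
    rw [semilocalGroundEnergy, semilocalGroundEnergy, he, he', Real.sInf_empty, sub_self, abs_zero]
    exact placeCap_nonneg p a
  · have hne' : (semilocalSphereValues (insert p S) P a).Nonempty :=
      (semilocalSphereValues_nonempty_iff _ P a).2 ((semilocalSphereValues_nonempty_iff S P a).1 hne)
    have hlo : semilocalGroundEnergy S P a - placeCap p a ≤ semilocalGroundEnergy (insert p S) P a := by
      refine le_semilocalGroundEnergy hne' fun g hg hs hP hn ↦ ?_
      have h1 := abs_re_weilSemilocalQuadratic_insert_sub_le hp S hg hs
      rw [hn, mul_one] at h1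
      have h2 := semilocalGroundEnergy_le_re (S := S) hg hs hP hn
      linarith [(abs_le.1 h1).1]
    have hhi : semilocalGroundEnergy (insert p S) P a - placeCap p a ≤ semilocalGroundEnergy S P a := by
      refine le_semilocalGroundEnergy hne fun g hg hs hP hn ↦ ?_
      have h1 := abs_re_weilSemilocalQuadratic_insert_sub_le hp S hg hs
      rw [hn, mul_one] at h1
      have h2 := semilocalGroundEnergy_le_re (S := insert p S) hg hs hP hn
      linarith [(abs_le.1 h1).2]
    exact abs_le.2 ⟨by linarith, by linarith⟩

/-- **LOCALITY**: for `a ≤ (log p)/2` the place `p` is invisible on `C(a)` — the value sets with and without `p` coincide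
(`W_p(g ⋆ g̃) = 0`, tree `weilSemilocalPrimeTerm_singleton_weilConv_eq_zero_of_le`). [cite: Yoshida1992HermitianForms, §2 eq. (2.1) (supp F ⊆ [−2a, 2a]: only p^m ≤ e^{2a} enter)] -/
theorem semilocalSphereValues_insert_eq_of_le (hp : p.Prime) (ha : a ≤ Real.log p / 2) (S : Finset ℕ)
    (P : (ℝ → ℂ) → Prop) : semilocalSphereValues (insert p S) P a = semilocalSphereValues S P a := by
  by_cases hpS : p ∈ S
  · rw [Finset.insert_eq_of_mem hpS]
  haveI : Fact p.Prime := ⟨hp⟩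
  have key : ∀ g : ℝ → ℂ, IsWeilTest g → tsupport g ⊆ Icc (-a) a →
      (weilSemilocalQuadratic (insert p S) g).re = (weilSemilocalQuadratic S g).re := fun g hg hs ↦ by
    rw [re_weilSemilocalQuadratic_insert hp hpS hg, weilSemilocalPrimeTerm_singleton_weilConv_eq_zero_of_le ha hg hs,
      Complex.zero_re, sub_zero]
  ext x
  constructor
  · rintro ⟨g, hg, hs, hP, hn, rfl⟩
    exact ⟨g, hg, hs, hP, hn, key g hg hs⟩
  · rintro ⟨g, hg, hs, hP, hn, rfl⟩
    exact ⟨g, hg, hs, hP, hn, (key g hg hs).symm⟩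

/-- Hence **`λ_min(S ∪ {p}; a; P) = λ_min(S; a; P)` for `a ≤ (log p)/2`** (every sector; the tables' exact zeros
`Δ_5(0.59) = Δ_5(0.75) = 0`, `d_{2,3} = d_{2,3,5}` below `(log 5)/2`, …). [cite: Yoshida1992HermitianForms, §2 eq. (2.1)] -/
theorem semilocalGroundEnergy_insert_eq_of_le (hp : p.Prime) (ha : a ≤ Real.log p / 2) (S : Finset ℕ)
    (P : (ℝ → ℂ) → Prop) : semilocalGroundEnergy (insert p S) P a = semilocalGroundEnergy S P a := by
  rw [semilocalGroundEnergy, semilocalGroundEnergy, semilocalSphereValues_insert_eq_of_le hp ha]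

/-! ## §4  The cumulants: pairing, vanishing, the a-priori bound, Möbius inversion -/

/-- **Pairing formula**: for `p ∉ T`,
`J^B_{T ∪ {p}} = Σ_{R ⊆ T} (−1)^{|T|−|R|} (λ_min(B ∪ R ∪ {p}) − λ_min(B ∪ R))` — a cumulant in `|T| + 1` places is a signed sum of
`2^{|T|}` ONE-PLACE increments. [folklore] -/
theorem semilocalCumulant_insert (hpT : p ∉ T) (B : Finset ℕ) (P : (ℝ → ℂ) → Prop) (a : ℝ) :
    semilocalCumulant B (insert p T) P a =
      ∑ R ∈ T.powerset, (-1 : ℝ) ^ (T.card - R.card) *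
        (semilocalGroundEnergy (B ∪ insert p R) P a - semilocalGroundEnergy (B ∪ R) P a) := by
  unfold semilocalCumulant
  rw [Finset.sum_powerset_insert hpT, Finset.card_insert_of_notMem hpT, ← Finset.sum_add_distrib]
  refine Finset.sum_congr rfl fun R hR ↦ ?_
  have hRT : R ⊆ T := Finset.mem_powerset.1 hR
  have hpR : p ∉ R := fun h ↦ hpT (hRT h)
  have hcard : R.card ≤ T.card := Finset.card_le_card hRT
  rw [Finset.card_insert_of_notMem hpR, show T.card + 1 - R.card = (T.card - R.card) + 1 by omega,
    show T.card + 1 - (R.card + 1) = T.card - R.card by omega, pow_succ]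
  ring

/-- `J^B_{{p}} = λ_min(B ∪ {p}) − λ_min(B)`: the one-body cumulant is the INCREMENT of the place `p` (the tables' `Δ_p` for `B = ∅`). [folklore] -/
theorem semilocalCumulant_singleton (B : Finset ℕ) (p : ℕ) (P : (ℝ → ℂ) → Prop) (a : ℝ) :
    semilocalCumulant B {p} P a = semilocalGroundEnergy (insert p B) P a - semilocalGroundEnergy B P a := by
  rw [← Finset.insert_empty, semilocalCumulant_insert (Finset.notMem_empty p)]
  simp [Finset.union_insert]

/-- A cumulant with one more place is a DIFFERENCE of cumulants over the two bases: for `p ∉ T`,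
`J^B_{T ∪ {p}} = J^{B ∪ {p}}_T − J^B_T`. [folklore] -/
theorem semilocalCumulant_insert_eq_sub (hpT : p ∉ T) (B : Finset ℕ) (P : (ℝ → ℂ) → Prop) (a : ℝ) :
    semilocalCumulant B (insert p T) P a = semilocalCumulant (insert p B) T P a - semilocalCumulant B T P a := by
  rw [semilocalCumulant_insert hpT, semilocalCumulant, semilocalCumulant, ← Finset.sum_sub_distrib]
  refine Finset.sum_congr rfl fun R _ ↦ ?_
  rw [Finset.union_insert, Finset.insert_union]
  ring

/-- **VANISHING (RH-free, exact)**: a cumulant containing a prime `p` that is INVISIBLE on the window (`a ≤ (log p)/2`) is `0` —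
for every base, sector and order (the hierarchy is triangular in the bandwidth: `J_{2,3,5,7}(b) = 0` for `b ≤ (log 7)/2`,
`J_{2,…,11}(b) = 0` for `b ≤ (log 11)/2`, the «—» cells of SEMILOCAL-TABLE §2e). [cite: Yoshida1992HermitianForms, §2 eq. (2.1); combinatorics folklore] -/
theorem semilocalCumulant_eq_zero_of_le (hp : p.Prime) (hpT : p ∈ T) (ha : a ≤ Real.log p / 2) (B : Finset ℕ)
    (P : (ℝ → ℂ) → Prop) : semilocalCumulant B T P a = 0 := by
  rw [← Finset.insert_erase hpT, semilocalCumulant_insert (Finset.notMem_erase p T)]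
  refine Finset.sum_eq_zero fun R _ ↦ ?_
  rw [Finset.union_insert, semilocalGroundEnergy_insert_eq_of_le hp ha, sub_self, mul_zero]

/-- **A-PRIORI BOUND (RH-free)**: `|J^B_T(a; P)| ≤ 2^{|T|−1}·placeCap(p, a)` for EVERY `p ∈ T` (pairing over `p`: `2^{|T|−1}` one-place
increments, each at most the place cap). Honest and far from the data: no decay in `|T|` is asserted or observed. [folklore] -/
theorem abs_semilocalCumulant_le (hp : p.Prime) (hpT : p ∈ T) (B : Finset ℕ) (P : (ℝ → ℂ) → Prop) (a : ℝ) :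
    |semilocalCumulant B T P a| ≤ 2 ^ (T.card - 1) * placeCap p a := by
  have hT : T = insert p (T.erase p) := (Finset.insert_erase hpT).symm
  have hcard : T.card - 1 = (T.erase p).card := by
    rw [Finset.card_erase_of_mem hpT]
  rw [hcard, hT, semilocalCumulant_insert (Finset.notMem_erase p T), Finset.erase_insert_eq_erase,
    Finset.erase_eq_of_notMem (Finset.notMem_erase p T)]
  refine (Finset.abs_sum_le_sum_abs _ _).trans
    ((Finset.sum_le_sum (g := fun _ ↦ placeCap p a) fun R _ ↦ ?_).trans_eq ?_)
  · rw [abs_mul, abs_pow, abs_neg, abs_one, one_pow, one_mul, Finset.union_insert]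
    exact abs_semilocalGroundEnergy_insert_sub_le hp _ P a
  · rw [Finset.sum_const, Finset.card_powerset, nsmul_eq_mul]
    push_cast
    ring

/-- The pair interaction is bounded by twice the SMALLER place cap: `|I^B_{pq}| ≤ 2·placeCap(p, a)` for each of its two primes. [folklore] -/
theorem abs_semilocalCumulant_pair_le (hp : p.Prime) (q : ℕ) (hpq : p ≠ q) (B : Finset ℕ) (P : (ℝ → ℂ) → Prop)
    (a : ℝ) : |semilocalCumulant B {p, q} P a| ≤ 2 * placeCap p a := by
  have h := abs_semilocalCumulant_le hp (T := {p, q}) (by simp) B P a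
  rwa [Finset.card_pair hpq, show 2 - 1 = 1 from rfl, pow_one] at h

/-- **MÖBIUS INVERSION on the Boolean lattice**: `λ_min(B ∪ T; a; P) = Σ_{R ⊆ T} J^B_R(a; P)` — the energy of the enlarged place set is
the sum of ALL connected terms; truncating at `|R| ≤ 2` is the cell's «pair model», whose residual is therefore exactly
`Σ_{R ⊆ T, |R| ≥ 3} J^B_R` (DATA: up to `0.62`). [folklore] -/
theorem semilocalGroundEnergy_union_eq_sum_semilocalCumulant (B T : Finset ℕ) (P : (ℝ → ℂ) → Prop) (a : ℝ) :
    semilocalGroundEnergy (B ∪ T) P a = ∑ R ∈ T.powerset, semilocalCumulant B R P a := by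
  induction T using Finset.induction_on generalizing B with
  | empty => simp [semilocalCumulant_empty]
  | insert p T hpT ih =>
    rw [Finset.sum_powerset_insert hpT, ← ih B]
    have h2 : ∑ R ∈ T.powerset, semilocalCumulant B (insert p R) P a =
        ∑ R ∈ T.powerset, (semilocalCumulant (insert p B) R P a - semilocalCumulant B R P a) :=
      Finset.sum_congr rfl fun R hR ↦
        semilocalCumulant_insert_eq_sub (fun h ↦ hpT (Finset.mem_powerset.1 hR h)) B P a
    rw [h2, Finset.sum_sub_distrib, ← ih (insert p B), ← ih B, Finset.union_insert, Finset.insert_union]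
    ring

/-! ## §5  Relay, not convergence: the defect against a larger place set / the full form -/

/-- **MANY-PLACE SANDWICH (RH-free)**: `|λ_min(S ∪ U; a; P) − λ_min(S; a; P)| ≤ Σ_{p ∈ U} placeCap(p, a)` for every finite set of
primes `U` (one place at a time). [folklore] -/
theorem abs_semilocalGroundEnergy_union_sub_le (hU : ∀ p ∈ U, p.Prime) (S : Finset ℕ) (P : (ℝ → ℂ) → Prop) (a : ℝ) :
    |semilocalGroundEnergy (S ∪ U) P a - semilocalGroundEnergy S P a| ≤ ∑ p ∈ U, placeCap p a := by
  induction U using Finset.induction_on with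
  | empty => simp
  | insert p U hpU ih =>
    have hp : p.Prime := hU p (Finset.mem_insert_self p U)
    have ih' := ih fun r hr ↦ hU r (Finset.mem_insert_of_mem hr)
    rw [Finset.sum_insert hpU, Finset.union_insert]
    exact (abs_sub_le _ (semilocalGroundEnergy (S ∪ U) P a) _).trans
      (add_le_add (abs_semilocalGroundEnergy_insert_sub_le hp _ P a) ih')

/-- **RELAY DEFECT against the full form (RH-free)**: for `a ≤ (log(N+1))/2` and every finite `S`, sector `P`,
`|λ_min(S; a; P) − inf {Re Q(g) : g ∈ C(a)^P, ‖g‖₂ = 1}| ≤ Σ_{p ≤ N prime, p ∉ S} placeCap(p, a)`: the defect `d_S(a)` of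
SEMILOCAL-TABLE §3 is carried by the VISIBLE MISSING primes only; if there are none it is `0` (tree
`semilocalGroundEnergy_eq_of_forall`) — at fixed bandwidth the «convergence in S» is finite and exact. [cite: ConnesConsani2023, §2.1.2 (only the prime powers below λ² enter QW_λ); bound: this track] -/
theorem abs_semilocalGroundEnergy_sub_sInf_le (ha : a ≤ Real.log ((N : ℝ) + 1) / 2) (S : Finset ℕ)
    (P : (ℝ → ℂ) → Prop) :
    |semilocalGroundEnergy S P a - sInf (weilWindowSphereValues P a)| ≤
      ∑ p ∈ Nat.primesBelow (N + 1) \ S, placeCap p a := by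
  have hsub : ∀ n ≤ N, IsPrimePow n → n.primeFactors ⊆ S ∪ (Nat.primesBelow (N + 1) \ S) := by
    intro n hn _ r hr
    have hr' := primeFactors_subset_primesBelow hn hr
    rw [Finset.mem_union, Finset.mem_sdiff]
    tauto
  have hfull : semilocalGroundEnergy (S ∪ (Nat.primesBelow (N + 1) \ S)) P a = sInf (weilWindowSphereValues P a) :=
    semilocalGroundEnergy_eq_of_forall (N := N) hsub ha
  rw [← hfull, abs_sub_comm]
  exact abs_semilocalGroundEnergy_union_sub_le
    (fun p hp ↦ (Nat.mem_primesBelow.1 (Finset.mem_sdiff.1 hp).1).2) S P a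

/-- All-sector form with Weil's ground energy `ε(a)`: `|λ_min(S; a) − ε(a)| ≤ Σ_{p ≤ N prime, p ∉ S} placeCap(p, a)` for
`a ≤ (log(N+1))/2`. [folklore] -/
theorem abs_semilocalGroundEnergy_sub_weilGroundEnergy_le (ha : a ≤ Real.log ((N : ℝ) + 1) / 2) (S : Finset ℕ) :
    |semilocalGroundEnergy S (fun _ ↦ True) a - weilGroundEnergy a| ≤
      ∑ p ∈ Nat.primesBelow (N + 1) \ S, placeCap p a := by
  rw [weilGroundEnergy_eq_sInf]
  exact abs_semilocalGroundEnergy_sub_sInf_le ha S _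

/-- Even-sector form: `|λ_min(S; a; even) − ε_ev(a)| ≤ Σ_{p ≤ N prime, p ∉ S} placeCap(p, a)` for `a ≤ (log(N+1))/2`. [folklore] -/
theorem abs_semilocalGroundEnergy_even_sub_le (ha : a ≤ Real.log ((N : ℝ) + 1) / 2) (S : Finset ℕ) :
    |semilocalGroundEnergy S (fun g ↦ ∀ t, g (-t) = g t) a - weilEvenGroundEnergy a| ≤
      ∑ p ∈ Nat.primesBelow (N + 1) \ S, placeCap p a := by
  rw [weilEvenGroundEnergy_eq_sInf]
  exact abs_semilocalGroundEnergy_sub_sInf_le ha S _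

/-- Odd-sector form: `|λ_min(S; a; odd) − ε_od(a)| ≤ Σ_{p ≤ N prime, p ∉ S} placeCap(p, a)` for `a ≤ (log(N+1))/2`. [folklore] -/
theorem abs_semilocalGroundEnergy_odd_sub_le (ha : a ≤ Real.log ((N : ℝ) + 1) / 2) (S : Finset ℕ) :
    |semilocalGroundEnergy S (fun g ↦ ∀ t, g (-t) = -g t) a - weilOddGroundEnergy a| ≤
      ∑ p ∈ Nat.primesBelow (N + 1) \ S, placeCap p a := by
  rw [weilOddGroundEnergy_eq_sInf]
  exact abs_semilocalGroundEnergy_sub_sInf_le ha S _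

/-! ## §6  The handoff link: the GAIN of the new prime is the one-body cumulant -/

/-- For consecutive primes `q < q'`: `S_{q'} = S_q ∪ {q}`. [folklore] -/
theorem primesBelow_eq_insert (h : ConsecutivePrimes q q') :
    Nat.primesBelow q' = insert q (Nat.primesBelow q) := by
  rw [h.primesBelow_eq, Nat.primesBelow_succ, if_pos h.1]

/-- **The gain is the one-body cumulant**: `G_q(b; P) := λ_min(S_{q'}; b; P) − λ_min(S_q; b; P) = J^{S_q}_{{q}}(b; P)`
(HANDOFF-STATEMENT §H.3). [folklore] -/
theorem semilocalCumulant_handoff_eq_gain (h : ConsecutivePrimes q q') (P : (ℝ → ℂ) → Prop) (b : ℝ) :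
    semilocalCumulant (Nat.primesBelow q) {q} P b =
      semilocalGroundEnergy (Nat.primesBelow q') P b - semilocalGroundEnergy (Nat.primesBelow q) P b := by
  rw [semilocalCumulant_singleton, primesBelow_eq_insert h]

/-- Below the window the new prime is SILENT: `G_q(b; P) = 0` for `b ≤ (log q)/2` (every sector). [cite: Yoshida1992HermitianForms, §2 eq. (2.1)] -/
theorem semilocalCumulant_handoff_eq_zero_of_le (hq : q.Prime) {b : ℝ} (hb : b ≤ Real.log q / 2)
    (P : (ℝ → ℂ) → Prop) : semilocalCumulant (Nat.primesBelow q) {q} P b = 0 :=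
  semilocalCumulant_eq_zero_of_le hq (Finset.mem_singleton_self q) hb _ P

/-- On the window the all-sector gain is `ε(b) + D_q(b)`: `G_q(b) = ε(b) − λ_min(S_q; b)` for `b ≤ (log q')/2` (locality
`λ_min(S_{q'}; b) = ε(b)` there). [folklore] -/
theorem semilocalCumulant_handoff_eq_weilGroundEnergy_add_aggregateDeficit (h : ConsecutivePrimes q q') {b : ℝ}
    (hb : b ≤ Real.log q' / 2) :
    semilocalCumulant (Nat.primesBelow q) {q} (fun _ ↦ True) b = weilGroundEnergy b + aggregateDeficit q b := by
  rw [semilocalCumulant_handoff_eq_gain h, semilocalGroundEnergy_window_top h hb, aggregateDeficit]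
  ring

/-- **The gain is capped (sharp)**: `|G_q(b)| ≤ cap(q) = (log q)/√q` for `0 < b ≤ (log q')/2` (`HandoffLoadCeiling`'s window
sandwich; `cap(q) = placeCap(q, b)/2` there — only the first power of `q` is visible and `|k(log q) + k(−log q)| ≤ ‖g‖₂²` on the
window). [cite: ConnesConsani2023, §2.2–2.3 (the contribution of the new prime); sharp cap: this track] -/
theorem abs_semilocalCumulant_handoff_le_cap (h : ConsecutivePrimes q q') {b : ℝ} (hb0 : 0 < b)
    (hb : b ≤ Real.log q' / 2) :
    |semilocalCumulant (Nat.primesBelow q) {q} (fun _ ↦ True) b| ≤ Real.log q / Real.sqrt q := by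
  rw [semilocalCumulant_handoff_eq_gain h, semilocalGroundEnergy_window_top h hb]
  exact abs_weilGroundEnergy_sub_semilocalGroundEnergy_le_cap h hb0 hb

/-- **`H(q) ⟺ D_q((log q')/2) ≤ G_q((log q')/2)`** — «aggregate deficit ≤ aggregate GAIN» at the window's right end is EQUIVALENT
to the handoff clause (both say `λ_min(S_{q'}; (log q')/2) ≥ 0`); the ONE aggregate reading that is an equivalence
(HANDOFF-STATEMENT §H.3 (a); with the maximal contribution `cap(q)` in place of the gain it is necessary only). [folklore] -/
theorem handoffH_iff_aggregateDeficit_le_gain (h : ConsecutivePrimes q q') :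
    HandoffH q q' ↔ aggregateDeficit q (Real.log q' / 2) ≤
      semilocalCumulant (Nat.primesBelow q) {q} (fun _ ↦ True) (Real.log q' / 2) := by
  rw [handoffH_iff_aggregateDeficit_nonpos h, semilocalCumulant_handoff_eq_gain h, aggregateDeficit, aggregateDeficit]
  constructor <;> intro H <;> linarith

end Summit.RiemannHypothesis.RiemannHypothesis.Theorems.HandoffInteraction
end
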